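import Summits.QuantumFields.YangMills.Theorems.UniversalDetectorRPDefect
import Summits.QuantumFields.YangMills.Theorems.UniversalDetectorReflectDefect
import Summits.QuantumFields.YangMills.Theorems.UniversalDetectorLatticeRiemannBounds

/-!
# Route `UniversalDetector`, support item `PlaneLimitExtraction` (stmt-QuantumFields-23251) — (TIGHT6) along the
route's sequences: the time-reflection defect tends to zero, and lattice reflection positivity of `Q2(ϑw, w)` holds
up to `-δ_k → 0`

Ideator seat ym-idea-8 g7 (LINE 4 of rung R2a = `BalabanLadder.NT`).  Sequential consequences of the hypothesis
(TIGHT6) of `PlaneLimitExtraction` (threshold form, `β ≥ β₅`, `a(β)L ≥ Λ₅`, one modulus per valid orientation pair)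
along `βs → ∞`, `a(βs k) Ls k → ∞`, `a → 0⁺`:

* `tight6_choose` — the 36 bounds / moduli chosen at once, with the inner statements holding eventually in `k`;
* `tendsto_sum_abs_moduli` — `Σ_{pq} |ω_pq(a(βs k))| → 0`;
* `reflect_defect_eventually` — for all `η, ε > 0`, eventually `|ker_k(ϑz) − ker_k(z)| ≤ ε` on the annulus
  `η ≤ ‖a_k z‖ ≤ η⁻¹` (the hypothesis `hinv` of `latticeLimit_invariant_approx` for `σ = ϑ`; with
  `reflect_defect_of_tight6`);
* `Q2_thetaTest_eventually_ge_neg` — for a slab-supported real Schwartz weight `w`, a sequence `δ_k → 0` with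
  eventually `-δ_k ≤ Q2 (βs k) (Ls k) (a(βs k)) (ϑw) w` (the hypothesis `hpos` of `integral_nonneg_of_Q2_ge_neg`; with
  `Q2_thetaTest_ge_neg_defect`, `rp_step_bound_of_tight6`, `schwartz_latticeRiemannBound`);
* `tsupport_thetaTest_subset_slab` — the reflected weight is carried by the reflected slab.

No summit, rung or crux is proved here.
-/

set_option autoImplicit false

noncomputable section

open scoped SchwartzMap
open MeasureTheory Filter Topology
open Literature.MathematicalPhysics.QuantumFieldTheory Literature.MathematicalPhysics.QuantumLattice
  Literature.Probability.LatticeModels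
open Summit.QuantumFields.YangMills.Cruxes.OSLegsFromFemtoAndGap.DlrCollarTransfer

namespace Summit.QuantumFields.YangMills.Cruxes.UniversalDetectorPlaneTight

variable {G : Type} [Group G] [TopologicalSpace G] [IsTopologicalGroup G] [CompactSpace G]
  [MeasurableSpace G] [BorelSpace G] (r : LatticeRep G)

/-- **The reflected weight lives on the reflected slab.** -/
theorem tsupport_thetaTest_subset_slab (w : 𝓢(EuclideanSpace ℝ (Fin 4), ℝ)) {t₀ T : ℝ}
    (hw : tsupport (w : EuclideanSpace ℝ (Fin 4) → ℝ) ⊆ {y | t₀ ≤ y 0 ∧ y 0 ≤ T}) :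
    tsupport (thetaTest 4 w : EuclideanSpace ℝ (Fin 4) → ℝ) ⊆ {y | t₀ ≤ -(y 0) ∧ -(y 0) ≤ T} := by
  intro y hy
  have hsub : Function.support (thetaTest 4 w : EuclideanSpace ℝ (Fin 4) → ℝ) ⊆
      timeReflection 4 ⁻¹' tsupport (w : EuclideanSpace ℝ (Fin 4) → ℝ) := by
    intro x hx
    rw [Function.mem_support, thetaTest_apply] at hx
    exact subset_tsupport _ (Function.mem_support.2 hx)
  have hcl : IsClosed (timeReflection 4 ⁻¹' tsupport (w : EuclideanSpace ℝ (Fin 4) → ℝ)) :=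
    (isClosed_tsupport _).preimage (timeReflection 4).continuous
  have hy' : timeReflection 4 y ∈ tsupport (w : EuclideanSpace ℝ (Fin 4) → ℝ) :=
    (closure_minimal hsub hcl) hy
  have h := hw hy'
  simpa only [Set.mem_setOf_eq, timeReflection_apply, if_true] using h

omit [MeasurableSpace G] [BorelSpace G] in
/-- **(TIGHT6) chosen at once.**  At a fixed separation `η > 0`, bounds `C_pq` and moduli `ω_pq → 0` for all valid
orientation pairs such that, eventually along `βs → ∞`, `a(βs k) Ls k → ∞`, the inner statement of (TIGHT6) holds
for every pair. -/
theorem tight6_choose [MeasurableSpace G] [BorelSpace G] (a : ℝ → ℝ)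
    (hT6 : ∀ p q : Fin 4 × Fin 4, p.1 < p.2 → q.1 < q.2 → ∀ η : ℝ, 0 < η → ∃ (C β₅ Λ₅ : ℝ) (ω : ℝ → ℝ),
      Tendsto ω (𝓝[>] 0) (𝓝 0) ∧ ∀ β : ℝ, β₅ ≤ β → ∀ L : ℕ, Λ₅ ≤ a β * L → ∀ z ∈ box 4 L,
        η ≤ ‖a β • siteToE z‖ →
          |(a β)⁻¹ ^ 8 * (torusE G r β L (fun U => plane G r p 0 U * plane G r q z U) -
              torusE G r β L (plane G r p 0) * torusE G r β L (plane G r q z))| ≤ C ∧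
            ∀ z' ∈ box 4 L, η ≤ ‖a β • siteToE z'‖ →
              |(a β)⁻¹ ^ 8 * (torusE G r β L (fun U => plane G r p 0 U * plane G r q z U) -
                  torusE G r β L (plane G r p 0) * torusE G r β L (plane G r q z)) -
                (a β)⁻¹ ^ 8 * (torusE G r β L (fun U => plane G r p 0 U * plane G r q z' U) -
                  torusE G r β L (plane G r p 0) * torusE G r β L (plane G r q z'))| ≤
                ω ‖a β • siteToE z - a β • siteToE z'‖)
    {η : ℝ} (hη : 0 < η) (βs : ℕ → ℝ) (Ls : ℕ → ℕ) (hβ : Tendsto βs atTop atTop)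
    (hL : Tendsto (fun k => a (βs k) * Ls k) atTop atTop) :
    ∃ (C : {q : Fin 4 × Fin 4 // q.1 < q.2} → {q : Fin 4 × Fin 4 // q.1 < q.2} → ℝ)
      (ω : {q : Fin 4 × Fin 4 // q.1 < q.2} → {q : Fin 4 × Fin 4 // q.1 < q.2} → ℝ → ℝ),
      (∀ p q, Tendsto (ω p q) (𝓝[>] 0) (𝓝 0)) ∧
      ∀ᶠ k in atTop, ∀ p q : {q : Fin 4 × Fin 4 // q.1 < q.2}, ∀ z ∈ box 4 (Ls k),
        η ≤ ‖a (βs k) • siteToE z‖ →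
          |(a (βs k))⁻¹ ^ 8 * (torusE G r (βs k) (Ls k) (fun U => plane G r p.1 0 U * plane G r q.1 z U) -
              torusE G r (βs k) (Ls k) (plane G r p.1 0) * torusE G r (βs k) (Ls k) (plane G r q.1 z))| ≤ C p q ∧
            ∀ z' ∈ box 4 (Ls k), η ≤ ‖a (βs k) • siteToE z'‖ →
              |(a (βs k))⁻¹ ^ 8 * (torusE G r (βs k) (Ls k) (fun U => plane G r p.1 0 U * plane G r q.1 z U) -
                  torusE G r (βs k) (Ls k) (plane G r p.1 0) * torusE G r (βs k) (Ls k) (plane G r q.1 z)) -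
                (a (βs k))⁻¹ ^ 8 * (torusE G r (βs k) (Ls k) (fun U => plane G r p.1 0 U * plane G r q.1 z' U) -
                  torusE G r (βs k) (Ls k) (plane G r p.1 0) * torusE G r (βs k) (Ls k) (plane G r q.1 z'))| ≤
                ω p q ‖a (βs k) • siteToE z - a (βs k) • siteToE z'‖ := by
  choose C β₅ Λ₅ ω hω h using
    fun p q : {q : Fin 4 × Fin 4 // q.1 < q.2} => hT6 p.1 q.1 p.2 q.2 η hη
  refine ⟨C, ω, hω, ?_⟩
  have e1 : ∀ᶠ k in atTop, ∀ pq : {q : Fin 4 × Fin 4 // q.1 < q.2} × {q : Fin 4 × Fin 4 // q.1 < q.2},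
      β₅ pq.1 pq.2 ≤ βs k := eventually_all.2 fun pq => hβ.eventually_ge_atTop _
  have e2 : ∀ᶠ k in atTop, ∀ pq : {q : Fin 4 × Fin 4 // q.1 < q.2} × {q : Fin 4 × Fin 4 // q.1 < q.2},
      Λ₅ pq.1 pq.2 ≤ a (βs k) * Ls k := eventually_all.2 fun pq => hL.eventually_ge_atTop _
  filter_upwards [e1, e2] with k h1 h2 p q z hz hzη
  exact h p q (βs k) (h1 (p, q)) (Ls k) (h2 (p, q)) z hz hzη

omit [Group G] [TopologicalSpace G] [IsTopologicalGroup G] [CompactSpace G] [MeasurableSpace G] [BorelSpace G] r in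
/-- The finitely many moduli tend to zero together along `s_k → 0⁺`. -/
theorem tendsto_sum_abs_moduli
    (ω : {q : Fin 4 × Fin 4 // q.1 < q.2} → {q : Fin 4 × Fin 4 // q.1 < q.2} → ℝ → ℝ)
    (hω : ∀ p q, Tendsto (ω p q) (𝓝[>] 0) (𝓝 0)) (s : ℕ → ℝ) (hs : ∀ k, 0 < s k)
    (hs0 : Tendsto s atTop (𝓝 0)) :
    Tendsto (fun k => ∑ p : {q : Fin 4 × Fin 4 // q.1 < q.2}, ∑ q : {q : Fin 4 × Fin 4 // q.1 < q.2},
      |ω p q (s k)|) atTop (𝓝 0) := by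
  have hs' : Tendsto s atTop (𝓝[>] 0) :=
    tendsto_nhdsWithin_iff.2 ⟨hs0, Eventually.of_forall fun k => Set.mem_Ioi.2 (hs k)⟩
  have hterm : ∀ p q : {q : Fin 4 × Fin 4 // q.1 < q.2},
      Tendsto (fun k => |ω p q (s k)|) atTop (𝓝 0) := fun p q => by
    simpa using ((hω p q).comp hs').abs
  have h1 : ∀ p : {q : Fin 4 × Fin 4 // q.1 < q.2},
      Tendsto (fun k => ∑ q : {q : Fin 4 × Fin 4 // q.1 < q.2}, |ω p q (s k)|) atTop (𝓝 0) := fun p => by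
    simpa using tendsto_finsetSum (Finset.univ) fun q _ => hterm p q
  simpa using tendsto_finsetSum (Finset.univ) fun p _ => h1 p

/-- **The time-reflection defect tends to zero along the route's sequences.**  Under (TIGHT6) (threshold form) for
the lattice spacing `a → 0⁺`, along `βs → ∞` with `a(βs k) Ls k → ∞`: for all `η, ε > 0`, eventually in `k`, for all
`z ∈ box 4 (Ls k)` with `η ≤ ‖a_k z‖ ≤ η⁻¹`, `|ker_k(ϑz) − ker_k(z)| ≤ ε` where `ker_k(z) = a_k⁻⁸ Cov_T(dens 0, dens z)`
on the torus `2 Ls k + 1` at coupling `βs k`. -/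
theorem reflect_defect_eventually (a : ℝ → ℝ) (ha : ∀ β, 0 < a β) (ha0 : Tendsto a atTop (𝓝 0))
    (hT6 : ∀ p q : Fin 4 × Fin 4, p.1 < p.2 → q.1 < q.2 → ∀ η : ℝ, 0 < η → ∃ (C β₅ Λ₅ : ℝ) (ω : ℝ → ℝ),
      Tendsto ω (𝓝[>] 0) (𝓝 0) ∧ ∀ β : ℝ, β₅ ≤ β → ∀ L : ℕ, Λ₅ ≤ a β * L → ∀ z ∈ box 4 L,
        η ≤ ‖a β • siteToE z‖ →
          |(a β)⁻¹ ^ 8 * (torusE G r β L (fun U => plane G r p 0 U * plane G r q z U) -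
              torusE G r β L (plane G r p 0) * torusE G r β L (plane G r q z))| ≤ C ∧
            ∀ z' ∈ box 4 L, η ≤ ‖a β • siteToE z'‖ →
              |(a β)⁻¹ ^ 8 * (torusE G r β L (fun U => plane G r p 0 U * plane G r q z U) -
                  torusE G r β L (plane G r p 0) * torusE G r β L (plane G r q z)) -
                (a β)⁻¹ ^ 8 * (torusE G r β L (fun U => plane G r p 0 U * plane G r q z' U) -
                  torusE G r β L (plane G r p 0) * torusE G r β L (plane G r q z'))| ≤
                ω ‖a β • siteToE z - a β • siteToE z'‖)
    (βs : ℕ → ℝ) (Ls : ℕ → ℕ) (hβ : Tendsto βs atTop atTop)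
    (hL : Tendsto (fun k => a (βs k) * Ls k) atTop atTop) :
    ∀ η ε : ℝ, 0 < η → 0 < ε → ∀ᶠ k in atTop, ∀ z ∈ box 4 (Ls k),
      η ≤ ‖a (βs k) • siteToE z‖ → ‖a (βs k) • siteToE z‖ ≤ η⁻¹ →
        |(a (βs k))⁻¹ ^ 8 * (torusE G r (βs k) (Ls k) (fun V => dens G r 0 V * dens G r (siteReflect z) V) -
            torusE G r (βs k) (Ls k) (dens G r 0) * torusE G r (βs k) (Ls k) (dens G r (siteReflect z))) -
          (a (βs k))⁻¹ ^ 8 * (torusE G r (βs k) (Ls k) (fun V => dens G r 0 V * dens G r z V) -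
            torusE G r (βs k) (Ls k) (dens G r 0) * torusE G r (βs k) (Ls k) (dens G r z))| ≤ ε := by
  intro η ε hη hε
  obtain ⟨C, ω, hω, hev⟩ := tight6_choose r a hT6 (half_pos hη) βs Ls hβ hL
  have hs : ∀ k, 0 < a (βs k) := fun k => ha _
  have hs0 : Tendsto (fun k => a (βs k)) atTop (𝓝 0) := ha0.comp hβ
  have e3 : ∀ᶠ k in atTop, 2 * a (βs k) ≤ η := by
    filter_upwards [hs0.eventually (eventually_le_nhds (half_pos hη))] with k hk
    linarith
  have e4 : ∀ᶠ k in atTop, η⁻¹ + a (βs k) ≤ a (βs k) * Ls k := by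
    filter_upwards [hs0.eventually (eventually_le_nhds one_pos), hL.eventually_ge_atTop (η⁻¹ + 1)] with k h1 h2
    linarith
  have e5 : ∀ᶠ k in atTop, ∑ p : {q : Fin 4 × Fin 4 // q.1 < q.2}, ∑ q : {q : Fin 4 × Fin 4 // q.1 < q.2},
      |ω p q (a (βs k))| ≤ ε :=
    (tendsto_sum_abs_moduli ω hω (fun k => a (βs k)) hs hs0).eventually (eventually_le_nhds hε)
  filter_upwards [hev, e3, e4, e5] with k hk h3 h4 h5 z hz hzη hzη'
  classical
  -- no time wrap: `a|z₀| ≤ ‖a z‖ ≤ η⁻¹` and `η⁻¹ + a ≤ aL`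
  have hz0 : |z 0| + 1 ≤ (Ls k : ℤ) := by
    have key : a (βs k) * |(z 0 : ℝ)| ≤ ‖a (βs k) • siteToE z‖ := by
      rw [norm_smul, Real.norm_of_nonneg (hs k).le]
      exact mul_le_mul_of_nonneg_left
        (by simpa [siteToE_apply, Real.norm_eq_abs] using PiLp.norm_apply_le (siteToE z) 0) (hs k).le
    have h1 : a (βs k) * (|(z 0 : ℝ)| + 1) ≤ a (βs k) * Ls k := by nlinarith
    have h2 : |(z 0 : ℝ)| + 1 ≤ Ls k := le_of_mul_le_mul_left h1 (hs k)
    have h3 : ((|z 0| + 1 : ℤ) : ℝ) ≤ ((Ls k : ℤ) : ℝ) := by push_cast; exact h2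
    exact_mod_cast h3
  have hmain := reflect_defect_of_tight6 r (βs k) (Ls k) (hs k) h3
    (fun p q => if h : p.1 < p.2 ∧ q.1 < q.2 then C ⟨p, h.1⟩ ⟨q, h.2⟩ else 0)
    (fun p q => if h : p.1 < p.2 ∧ q.1 < q.2 then ω ⟨p, h.1⟩ ⟨q, h.2⟩ else 0)
    (fun p q hp hq z₁ hz₁ hη₁ => by
      simp only [dif_pos (show p.1 < p.2 ∧ q.1 < q.2 from ⟨hp, hq⟩)]
      exact hk ⟨p, hp⟩ ⟨q, hq⟩ z₁ hz₁ hη₁)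
    hz hz0 hzη
  rw [abs_sub_comm]
  refine hmain.trans (le_trans (le_of_eq ?_) h5)
  refine Finset.sum_congr rfl fun p _ => Finset.sum_congr rfl fun q _ => ?_
  rw [dif_pos ⟨p.2, q.2⟩]

/-- **Lattice reflection positivity of `Q2(ϑw, w)` up to `-δ_k → 0` along the route's sequences.**  Under (TIGHT6)
(threshold form) for `a → 0⁺`, along `βs → ∞` with `a(βs k) Ls k → ∞`: for every real Schwartz weight `w` carried by a
time slab `t₀ ≤ y₀ ≤ T` (`t₀ > 0`) there is `δ_k → 0` with, eventually, `-δ_k ≤ Q2 (βs k) (Ls k) (a(βs k)) (ϑw) w`. -/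
theorem Q2_thetaTest_eventually_ge_neg (a : ℝ → ℝ) (ha : ∀ β, 0 < a β) (ha0 : Tendsto a atTop (𝓝 0))
    (hT6 : ∀ p q : Fin 4 × Fin 4, p.1 < p.2 → q.1 < q.2 → ∀ η : ℝ, 0 < η → ∃ (C β₅ Λ₅ : ℝ) (ω : ℝ → ℝ),
      Tendsto ω (𝓝[>] 0) (𝓝 0) ∧ ∀ β : ℝ, β₅ ≤ β → ∀ L : ℕ, Λ₅ ≤ a β * L → ∀ z ∈ box 4 L,
        η ≤ ‖a β • siteToE z‖ →
          |(a β)⁻¹ ^ 8 * (torusE G r β L (fun U => plane G r p 0 U * plane G r q z U) -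
              torusE G r β L (plane G r p 0) * torusE G r β L (plane G r q z))| ≤ C ∧
            ∀ z' ∈ box 4 L, η ≤ ‖a β • siteToE z'‖ →
              |(a β)⁻¹ ^ 8 * (torusE G r β L (fun U => plane G r p 0 U * plane G r q z U) -
                  torusE G r β L (plane G r p 0) * torusE G r β L (plane G r q z)) -
                (a β)⁻¹ ^ 8 * (torusE G r β L (fun U => plane G r p 0 U * plane G r q z' U) -
                  torusE G r β L (plane G r p 0) * torusE G r β L (plane G r q z'))| ≤
                ω ‖a β • siteToE z - a β • siteToE z'‖)
    (βs : ℕ → ℝ) (Ls : ℕ → ℕ) (hβ : Tendsto βs atTop atTop)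
    (hL : Tendsto (fun k => a (βs k) * Ls k) atTop atTop)
    (w : 𝓢(EuclideanSpace ℝ (Fin 4), ℝ)) {t₀ T : ℝ} (ht₀ : 0 < t₀)
    (hw : tsupport (w : EuclideanSpace ℝ (Fin 4) → ℝ) ⊆ {y | t₀ ≤ y 0 ∧ y 0 ≤ T}) :
    ∃ δ : ℕ → ℝ, Tendsto δ atTop (𝓝 0) ∧
      ∀ᶠ k in atTop, -δ k ≤ Q2 G r (βs k) (Ls k) (a (βs k)) (thetaTest 4 w) w := by
  obtain ⟨C, ω, hω, hev⟩ := tight6_choose r a hT6 (by positivity : (0 : ℝ) < 2 * t₀) βs Ls hβ hL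
  obtain ⟨B, hB0, hB⟩ :=
    Summit.QuantumFields.YangMills.Cruxes.UniversalDetectorLimitExtraction.schwartz_latticeRiemannBound (d := 4) w
  have hs : ∀ k, 0 < a (βs k) := fun k => ha _
  have hs0 : Tendsto (fun k => a (βs k)) atTop (𝓝 0) := ha0.comp hβ
  set Ω : ℕ → ℝ := fun k => ∑ p : {q : Fin 4 × Fin 4 // q.1 < q.2}, ∑ q : {q : Fin 4 × Fin 4 // q.1 < q.2},
    |ω p q (a (βs k))| with hΩ
  have hΩ0 : Tendsto Ω atTop (𝓝 0) := tendsto_sum_abs_moduli ω hω (fun k => a (βs k)) hs hs0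
  have hΩnn : ∀ k, 0 ≤ Ω k := fun k =>
    Finset.sum_nonneg fun _ _ => Finset.sum_nonneg fun _ _ => abs_nonneg _
  refine ⟨fun k => 36 * Ω k * B ^ 2, by simpa using (hΩ0.const_mul 36).mul_const (B ^ 2), ?_⟩
  have e0 : ∀ᶠ k in atTop, 0 ≤ βs k := hβ.eventually_ge_atTop 0
  have es1 : ∀ᶠ k in atTop, a (βs k) ≤ 1 := hs0.eventually (eventually_le_nhds one_pos)
  have eL : ∀ᶠ k in atTop, 2 * |T| + 2 ≤ a (βs k) * Ls k := hL.eventually_ge_atTop _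
  filter_upwards [hev, e0, es1, eL] with k hk h0 hs1 hkL
  have hT1 := le_abs_self T
  -- side conditions of the one-coupling lemmas
  have hL1 : 1 ≤ Ls k := by
    have h1 : (1 : ℝ) ≤ a (βs k) * Ls k := by linarith [abs_nonneg T]
    have h2 : a (βs k) * Ls k ≤ Ls k := by
      have := Nat.cast_nonneg (α := ℝ) (Ls k); nlinarith
    exact_mod_cast h1.trans h2
  have h2a : T + 2 * a (βs k) ≤ a (βs k) * Ls k := by linarith [abs_nonneg T]
  have h2b : 2 * T + a (βs k) ≤ a (βs k) * Ls k := by linarith [abs_nonneg T]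
  -- the common one-step bound `E = a⁸ Ω`
  set E : ℝ := a (βs k) ^ 8 * Ω k with hE
  have hE0 : 0 ≤ E := by positivity
  have hstep : ∀ x ∈ box 4 (Ls k), ∀ y ∈ box 4 (Ls k), t₀ ≤ a (βs k) * (x 0 : ℝ) → a (βs k) * (x 0 : ℝ) ≤ T →
      t₀ ≤ a (βs k) * (y 0 : ℝ) → a (βs k) * (y 0 : ℝ) ≤ T → ∀ p q : {q : Fin 4 × Fin 4 // q.1 < q.2},
      |(torusE G r (βs k) (Ls k) (fun V => plane G r p.1 0 V * plane G r q.1 (siteReflect x - y) V) -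
          torusE G r (βs k) (Ls k) (plane G r p.1 0) *
            torusE G r (βs k) (Ls k) (plane G r q.1 (siteReflect x - y))) -
        (torusE G r (βs k) (Ls k) (fun V => plane G r p.1 0 V *
            plane G r q.1 ((if q.1.1 = 0 then siteReflect x - Pi.single 0 1 else siteReflect x) - y) V) -
          torusE G r (βs k) (Ls k) (plane G r p.1 0) *
            torusE G r (βs k) (Ls k)
              (plane G r q.1 ((if q.1.1 = 0 then siteReflect x - Pi.single 0 1 else siteReflect x) - y)))| ≤ E := by
    intro x _ y _ hx1 hx2 hy1 hy2 p q
    have hkpq : ∀ z₁ ∈ box 4 (Ls k), 2 * t₀ ≤ ‖a (βs k) • siteToE z₁‖ →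
        |(a (βs k))⁻¹ ^ 8 * (torusE G r (βs k) (Ls k) (fun U => plane G r p.1 0 U * plane G r q.1 z₁ U) -
            torusE G r (βs k) (Ls k) (plane G r p.1 0) * torusE G r (βs k) (Ls k) (plane G r q.1 z₁))| ≤ C p q ∧
          ∀ z₂ ∈ box 4 (Ls k), 2 * t₀ ≤ ‖a (βs k) • siteToE z₂‖ →
            |(a (βs k))⁻¹ ^ 8 * (torusE G r (βs k) (Ls k) (fun U => plane G r p.1 0 U * plane G r q.1 z₁ U) -
                torusE G r (βs k) (Ls k) (plane G r p.1 0) * torusE G r (βs k) (Ls k) (plane G r q.1 z₁)) -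
              (a (βs k))⁻¹ ^ 8 * (torusE G r (βs k) (Ls k) (fun U => plane G r p.1 0 U * plane G r q.1 z₂ U) -
                torusE G r (βs k) (Ls k) (plane G r p.1 0) * torusE G r (βs k) (Ls k) (plane G r q.1 z₂))| ≤
              (fun t => |ω p q t|) ‖a (βs k) • siteToE z₁ - a (βs k) • siteToE z₂‖ := by
      intro z₁ hz₁ hη₁
      obtain ⟨hb, hc⟩ := hk p q z₁ hz₁ hη₁
      exact ⟨hb, fun z₂ hz₂ hη₂ => (hc z₂ hz₂ hη₂).trans (le_abs_self _)⟩
    have h1 := rp_step_bound_of_tight6 r (βs k) (Ls k) (hs k) ht₀ h2b p.1 q.1 (C p q) (fun t => |ω p q t|)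
      (abs_nonneg _) hkpq hx1 hx2 hy1 hy2
    refine h1.trans ?_
    rw [hE]
    refine mul_le_mul_of_nonneg_left ?_ (by positivity)
    calc |ω p q (a (βs k))| ≤ ∑ q' : {q : Fin 4 × Fin 4 // q.1 < q.2}, |ω p q' (a (βs k))| :=
          Finset.single_le_sum (f := fun q' => |ω p q' (a (βs k))|) (fun _ _ => abs_nonneg _) (Finset.mem_univ q)
      _ ≤ Ω k := Finset.single_le_sum (f := fun p' => ∑ q' : {q : Fin 4 × Fin 4 // q.1 < q.2}, |ω p' q' (a (βs k))|)
          (fun _ _ => Finset.sum_nonneg fun _ _ => abs_nonneg _) (Finset.mem_univ p)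
  have hQ := Q2_thetaTest_ge_neg_defect r h0 hL1 (hs k) ht₀ h2a w hw hE0 hstep
  -- `36 E (Σ|w(a x)|)² = 36 Ω (a⁴ Σ|w(a x)|)² ≤ 36 Ω B²`
  have hR := hB (Ls k) (a (βs k)) (hs k) hs1
  have hR0 : 0 ≤ a (βs k) ^ 4 * ∑ x ∈ box 4 (Ls k), |w (a (βs k) • siteToE x)| := by positivity
  have hsq : (a (βs k) ^ 4 * ∑ x ∈ box 4 (Ls k), |w (a (βs k) • siteToE x)|) ^ 2 ≤ B ^ 2 :=
    pow_le_pow_left₀ hR0 hR 2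
  have hcmp : 36 * E * (∑ x ∈ box 4 (Ls k), |w (a (βs k) • siteToE x)|) ^ 2 ≤ 36 * Ω k * B ^ 2 := by
    have : 36 * E * (∑ x ∈ box 4 (Ls k), |w (a (βs k) • siteToE x)|) ^ 2 =
        36 * Ω k * (a (βs k) ^ 4 * ∑ x ∈ box 4 (Ls k), |w (a (βs k) • siteToE x)|) ^ 2 := by
      rw [hE]; ring
    rw [this]
    exact mul_le_mul_of_nonneg_left hsq (by positivity)
  linarith

end Summit.QuantumFields.YangMills.Cruxes.UniversalDetectorPlaneTight

end
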